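import Literature.Probability.RandomMatrix.TwoQubitSeparabilityVolumes

/-!
# Lovas–Andai 2017, Corollary 2 + Theorem 2 on the maximally mixed fibre — proofs, part 1

Towards `LovasAndai2017_rebit_fibre_separability_probability_holds`
(`Literature/Probability/RandomMatrix/TwoQubitSeparabilityVolumes.lean`): the conditional two-rebit
Hilbert–Schmidt separability probability over the fibre `Tr₁ ρ = ½·1₂` is `29/64`
[LovasAndai2017, Cor. 2 with Thm. 2].

## This file (step S0 of the plan in the seat notes): the PPT condition on the fibre is a spectral condition

On the fibre `ρ = [[X, Z], [Zᵀ, ½ − X]]` the partial transpose `T ρ = [[X, Zᵀ], [Z, ½ − X]]` is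
ORTHOGONALLY SIMILAR to `½·1 − ρ = [[½ − X, −Z], [−Zᵀ, X]]`: swap the two block rows/columns and
conjugate by `diag(1, 1, −1, −1)`, i.e. `T ρ = Q (½ − ρ) Qᵀ` for the signed permutation matrix
`Q = [[0,0,1,0],[0,0,0,1],[−1,0,0,0],[0,−1,0,0]]`. Hence `T ρ ≻ 0 ↔ ½·1 − ρ ≻ 0` (the two-rebit
analogue of Zhang–Jiang–Xie's Prop. 6.9 for `D⁰`: on the maximally mixed fibre, PPT ⟺ `λ_max(ρ) < ½`),
and the fact is equivalent to `64 · vol{0 ≺ ρ ≺ ½} = 29 · vol{0 ≺ ρ}` on the chart `ℝ⁷`.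

## References

* [LovasAndai2017] A. Lovas, A. Andai, J. Phys. A 50 (2017) 295303, §3 (the involution `T`,
  Cor. 2, Thm. 2). arXiv:1610.01410.
* [ZhangJiangXie2025] Zhang–Jiang–Xie, QIC 25 (2025), Prop. 6.9 (the complex analogue).
-/

noncomputable section

open MeasureTheory
open scoped ENNReal Matrix

namespace Literature.Probability.RandomMatrix

/-- On the maximally mixed fibre the partial transpose is a signed block swap of `½·1 − ρ`:
`T ρ(x) = D · (½·1 − ρ(x))[σ, σ] · D` with the block-swap permutation `σ = (0 2)(1 3)` and the
sign matrix `D = diag(1, 1, −1, −1)` (an orthogonal similarity).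
[cite: LovasAndai2017, §3 (the involution T); entrywise identity] -/
theorem rebitFibreMatrixPT_eq_conj (x : Fin 7 → ℝ) :
    rebitFibreMatrixPT x =
      Matrix.diagonal ![(1 : ℝ), 1, -1, -1] *
        ((2 : ℝ)⁻¹ • (1 : Matrix (Fin 4) (Fin 4) ℝ) - rebitFibreMatrix x).submatrix
          ![2, 3, 0, 1] ![2, 3, 0, 1] *
        Matrix.diagonal ![(1 : ℝ), 1, -1, -1] := by
  ext i j
  fin_cases i <;> fin_cases j <;>
    simp [rebitFibreMatrix, rebitFibreMatrixPT, Matrix.mul_diagonal, Matrix.diagonal_mul,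
      Matrix.one_apply]

/-- **PPT on the maximally mixed fibre is the spectral condition `ρ ≺ ½·1`.** For every point of
the fibre chart, `T ρ(x) ≻ 0 ↔ ½·1 − ρ(x) ≻ 0` (rebit analogue of [ZhangJiangXie2025, Prop. 6.9]).
[cite: LovasAndai2017, §3 (T and the PPT criterion 𝒟ˢ = T(𝒟) ∩ 𝒟)] -/
theorem posDef_rebitFibreMatrixPT_iff (x : Fin 7 → ℝ) :
    (rebitFibreMatrixPT x).PosDef ↔
      ((2 : ℝ)⁻¹ • (1 : Matrix (Fin 4) (Fin 4) ℝ) - rebitFibreMatrix x).PosDef := by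
  have hσσ : ((![2, 3, 0, 1] : Fin 4 → Fin 4) ∘ (![2, 3, 0, 1] : Fin 4 → Fin 4)) = id := by
    funext i
    fin_cases i <;> rfl
  have hσinj : Function.Injective (![2, 3, 0, 1] : Fin 4 → Fin 4) :=
    Function.LeftInverse.injective (g := (![2, 3, 0, 1] : Fin 4 → Fin 4)) fun i => by
      have := congrFun hσσ i
      simpa using this
  have hDD : Matrix.diagonal ![(1 : ℝ), 1, -1, -1] * Matrix.diagonal ![(1 : ℝ), 1, -1, -1] = 1 := by
    rw [Matrix.diagonal_mul_diagonal, ← Matrix.diagonal_one]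
    exact congrArg Matrix.diagonal (funext fun i => by fin_cases i <;> simp)
  have hunit : IsUnit (Matrix.diagonal ![(1 : ℝ), 1, -1, -1]) := IsUnit.of_mul_eq_one _ hDD
  have hstar : star (Matrix.diagonal ![(1 : ℝ), 1, -1, -1]) =
      Matrix.diagonal ![(1 : ℝ), 1, -1, -1] := by
    rw [Matrix.star_eq_conjTranspose, Matrix.diagonal_conjTranspose]
    exact congrArg Matrix.diagonal (funext fun i => by fin_cases i <;> simp)
  rw [rebitFibreMatrixPT_eq_conj x]
  have h1 := Matrix.IsUnit.posDef_star_right_conjugate_iff hunit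
    (x := ((2 : ℝ)⁻¹ • (1 : Matrix (Fin 4) (Fin 4) ℝ) - rebitFibreMatrix x).submatrix
      ![2, 3, 0, 1] ![2, 3, 0, 1])
  rw [hstar] at h1
  rw [h1]
  constructor
  · intro h
    have h' := h.submatrix hσinj
    rwa [Matrix.submatrix_submatrix, hσσ, Matrix.submatrix_id_id] at h'
  · intro h
    exact h.submatrix hσinj

/-- **Restatement of the fact through `S0`.** Lovas–Andai's fibre statement is equivalent to
`64 · vol{x : 0 ≺ ρ(x) ≺ ½·1} = 29 · vol{x : 0 ≺ ρ(x)}` on the chart `ℝ⁷`.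
[cite: LovasAndai2017, Corollary 2 and Theorem 2] -/
theorem LovasAndai2017_rebit_fibre_separability_probability_iff_spectral :
    LovasAndai2017_rebit_fibre_separability_probability ↔
      64 * volume {x : Fin 7 → ℝ | (rebitFibreMatrix x).PosDef ∧
          ((2 : ℝ)⁻¹ • (1 : Matrix (Fin 4) (Fin 4) ℝ) - rebitFibreMatrix x).PosDef} =
        29 * volume {x : Fin 7 → ℝ | (rebitFibreMatrix x).PosDef} := by
  simp only [LovasAndai2017_rebit_fibre_separability_probability, posDef_rebitFibreMatrixPT_iff]

end Literature.Probability.RandomMatrix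

end
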